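import Literature.Topology.FourManifolds.CerfTheoremOne
import Literature.Topology.FourManifolds.CerfPropositionFour
import HarnessLib

/-!
# Cerf's Théorème 1 as printed, proved from the tree's single Cerf leaf `π₀(Diff(D³; S²)) = 0`

Cerf, *Sur les difféomorphismes de la sphère de dimension trois (Γ₄ = 0)*, LNM 53 (1968), Ch. I
§1, Théorème 1: « Le groupe `π₀(Diff S³)` est nul », `Diff S³` the orientation-preserving `C^∞`
diffeomorphisms (convention fixed in the first paragraph of Ch. I §1), whose identity component
is its component by smooth arcs (loc. cit.). In the tree's language: *every self-diffeomorphism of `𝕊³` preserving a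
smooth orientation `o` (`Diffeomorph.IsOrientationPreserving`, `SmoothOrientation.lean`) is
diffeotopic to the identity* (`Literature.Topology.FourManifolds.Diffeomorph.IsDiffeotopicToId`,
`Diffeotopy.lean`). This printed, oriented reading is **not** a separate named fact of the tree
(it is equivalent to the orientation-free paraphrase
`Literature.Topology.FourManifolds.cerf_pi0Diff_sphere_three` of `RadialExtension.lean`, see
`CerfTheoremOne.lean`, and an equivalent restatement is not a separate obligation); it is the
*theorem* `Literature.Topology.FourManifolds.isDiffeotopicToId_of_isOrientationPreserving_of_relBoundary`
below, from the leaf.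

**Architecture of the printed proof** (Introduction, pp. IX–XI; Ch. I §§2–3). Cerf never attacks
Théorème 1 directly; he proves the chain

* Théorème 1 ⟺ (2) `π₀(Diff(D³; S²)) = 0` — "d'après la proposition 4 de l'Appendice"
  (`π_i(Diff Sⁿ) ≈ π_i(𝒦) ⊕ π_i(SO(n+1))`, `𝒦` the diffeomorphisms of `Dⁿ` infinitely tangent to
  the identity along `Sⁿ⁻¹`; Ch. I §2, first sentence);
* (2) ⟺ `π₀(Diff D³) = 0` — fibration `Diff D³ → Diff S²` (Appendice, Thm. 1) and Smale's theorem
  `π_i(SO(3)) ≅ π_i(Diff S²)` (Appendice, Thm. 4), exact sequence (3) of Ch. I §2;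
* ⟺ Théorème 1′ — the covering `ℛ = ℰ/𝒢ₑ → ℰ/𝒢` of the "space of `3`-discs of `ℝ³`" has a
  continuous section (Appendice, Thm. 3 and Prop. 3: `ℰ = Emb⁺(D³, ℝ³)` is connected);
* ⟺ Théorème 1″ — the same covering over the space `ℱ/𝒦` of `2`-spheres of `ℝ³` (Ch. I §3,
  Lemme 4, using the smooth Schönflies theorem for `S² ⊂ ℝ³`, Alexander / Morse–Baiada, reproved
  in Ch. III §5);
* ⟸ Théorème 1‴ — a section over the strata `(ℱ/𝒦)⁰ ∪ (ℱ/𝒦)¹` of codimension `≤ 1` of the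
  natural stratification of `C^∞(S², ℝ)` suffices (Ch. I §4, Lemme 6; Ch. II, Props. 3–7, Thom
  transversality), constructed by induction on the Alexander complexity in Chapters IV–VI.

None of these links is within reach of Mathlib (no `C^∞` topology on `Diff`/`Emb`, no
isotopy-extension or fibration theorems for embedding spaces, no Smale theorem, no Schönflies, no
Morse/Cerf stratification); the theorem is theory-sized and its content stays in the tree as a
named fact — the single leaf (2) below. What the tree *has* done (sorry-free) is the first link at
`i = 0`: `CerfPropositionFour.lean` proves the surjectivity half of Proposition 4,
`π₀(𝒦ₙ) × π₀ O(n+1) ↠ π₀ Diff(𝕊ⁿ)`, flow-free, for every `n`, and vendors (2) as the named fact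
`Literature.Topology.FourManifolds.cerf_pi0DiffDisc_relBoundary_three`. This file closes the
triangle for the statement *as printed* (oriented form), so that Théorème 1 as printed and the
tree's five Cerf named facts (`cerf_pi0Diff_sphere_three`, `cerf_isotopy_sphere_three`,
`cerf_diffeomorph_sphere_three_extends_ball`, `cerf_twistedSphere_four`,
`cerf_pi0DiffDisc_relBoundary_three`) visibly hang off the single leaf (2):

* `Literature.Topology.FourManifolds.Diffeomorph.isDiffeotopicToId_of_isOrientationPreserving_of_compactDiffeotopyTrivial` —
  PROVED for all `n ≠ 0`: **if `π₀` of the compactly supported diffeomorphisms of `ℝⁿ` is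
  trivial, every orientation-preserving diffeomorphism of `𝕊ⁿ` is diffeotopic to the identity**
  (Cerf's Proposition 4 at `i = 0` in the printed, oriented reading: `π₀(𝒦ₙ) = 0 ⟹ π₀(Diff⁺ Sⁿ) = 0`).
  Proof: by the orientation-free form (`…_or_isDiffeotopic_sphereReflection_of_compactDiffeotopyTrivial`)
  `φ ~ id` or `φ ~ ρ`, a hyperplane reflection; the second is impossible for orientation-preserving
  `φ`, since the orientation character is a diffeotopy invariant (`OrientationDiffeotopy.lean`) and
  `ρ` reverses every orientation of `𝕊ⁿ`, `n ≠ 0` (`CerfTheoremOne.lean`). (`n = 0` is genuinely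
  excluded: the swap of `S⁰ = {±1}` preserves the constant orientation and is not diffeotopic to
  the identity.)
* `Literature.Topology.FourManifolds.isDiffeotopicToId_of_isOrientationPreserving_of_relBoundary` —
  **Cerf, Ch. I §2: (2) ⟹ Théorème 1 as printed** (`n = 3`, hypothesis = the named leaf).
* `Literature.Topology.FourManifolds.Diffeomorph.isDiffeotopicToId_of_isOrientationPreserving_circle` — the case `n = 1`,
  unconditionally (the hypothesis holds on the line, `unitBallDiffeotopyTrivial_euclideanSpace_one`):
  **every orientation-preserving diffeomorphism of `S¹` is diffeotopic to the identity**,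
  `π₀(Diff⁺ S¹) = 0` — the oriented companion of the tree's
  `isDiffeotopicToId_or_isDiffeotopic_sphereReflection_circle` and a non-vacuity witness for the
  general statement.

No new definition, no new named fact; imports `CerfTheoremOne` + `CerfPropositionFour` (neither
imports the other; no cycle).

## References

* J. Cerf, *Sur les difféomorphismes de la sphère de dimension trois (Γ₄ = 0)*, Lecture Notes in
  Mathematics 53, Springer (1968): Introduction pp. IX–XI; Ch. I §1 Théorème 1, §2 (statement (2),
  exact sequence (3)), §3 Lemme 4, Théorème 1″; Appendice §5, Propositions 3, 4, Théorème 4.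
  [CerfDiffeoSphere1968]
* A. Hatcher, *A proof of the Smale conjecture, `Diff(S³) ≃ O(4)`*, Ann. of Math. 117 (1983),
  553–607 (second proof of Théorème 1).
* M. W. Hirsch, *Differential Topology*, GTM 33 (1976), Ch. 4 §4 (reflections reverse orientation).
-/

open scoped Manifold ContDiff Topology
open Set Function Metric Module

noncomputable section

namespace Literature.Topology.FourManifolds

variable {n : ℕ}

/-! ### Proposition 4 at `i = 0`, oriented form: `π₀(𝒦ₙ) = 0 ⟹ π₀(Diff⁺ Sⁿ) = 0` -/

/-- **Cerf (1968), Appendice, Proposition 4 at `i = 0`, in the printed (oriented) reading.** If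
`π₀` of the compactly supported diffeomorphisms of `ℝⁿ` is trivial (`CompactDiffeotopyTrivial`,
`DiffeotopyTransport.lean`: Cerf's `π₀(𝒦) = 0`), then for `n ≠ 0` every self-diffeomorphism of
`𝕊ⁿ` preserving a smooth orientation `o` is diffeotopic to the identity: `π₀(Diff⁺ Sⁿ) = 0` in the
convention of Ch. I §1. From the orientation-free form
(`Diffeomorph.isDiffeotopicToId_or_isDiffeotopic_sphereReflection_of_compactDiffeotopyTrivial`:
`φ ~ id` or `φ ~ ρ_v`) — the alternative `φ ~ ρ_v` would make `ρ_v` orientation preserving like `φ`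
(`Diffeomorph.IsDiffeotopic.isOrientationPreserving_iff`), whereas a hyperplane reflection of `𝕊ⁿ`,
`n ≠ 0`, reverses every orientation (`sphereReflection_isOrientationReversing_of_ne_zero`).
[cite: CerfDiffeoSphere1968, Appendice §5, Prop. 4; Ch. I §2, first sentence] -/
theorem Diffeomorph.isDiffeotopicToId_of_isOrientationPreserving_of_compactDiffeotopyTrivial
    (hn : n ≠ 0) (hK : CompactDiffeotopyTrivial (EuclideanSpace ℝ (Fin n)))
    (o : SmoothOrientation (𝓡 n) (Metric.sphere (0 : EuclideanSpace ℝ (Fin (n + 1))) 1))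
    (φ : (Metric.sphere (0 : EuclideanSpace ℝ (Fin (n + 1))) 1) ≃ₘ⟮𝓡 n, 𝓡 n⟯
      (Metric.sphere (0 : EuclideanSpace ℝ (Fin (n + 1))) 1))
    (hφ : φ.IsOrientationPreserving o o) : Diffeomorph.IsDiffeotopicToId φ := by
  rcases Diffeomorph.isDiffeotopicToId_or_isDiffeotopic_sphereReflection_of_compactDiffeotopyTrivial
      hK (sphereBasePoint n) φ with h1 | h1
  · exact h1
  · exfalso
    haveI : Nonempty (Metric.sphere (0 : EuclideanSpace ℝ (Fin (n + 1))) 1) := ⟨sphereBasePoint n⟩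
    have hρ : (sphereReflection (sphereBasePoint n)).IsOrientationReversing o o :=
      sphereReflection_isOrientationReversing_of_ne_zero hn (sphereBasePoint n) o
    have hρ' : (sphereReflection (sphereBasePoint n)).IsOrientationPreserving o o :=
      (h1.isOrientationPreserving_iff o o).mpr hφ
    exact hρ'.not_isOrientationReversing hρ

/-- The same with the hypothesis in Cerf's form (2): `π₀` of the diffeomorphisms of `ℝⁿ` supported
in the closed unit ball, with unit-ball-supported diffeotopies, is trivial
(`UnitBallDiffeotopyTrivial` = `π₀(Diff(Dⁿ; Sⁿ⁻¹)) = 0`; it implies the compactly supported form by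
conjugating with homotheties, `CompactDiffeotopyTrivial.of_unitBall`). For `n ≠ 0`:
`π₀(Diff(Dⁿ; Sⁿ⁻¹)) = 0 ⟹ π₀(Diff⁺ Sⁿ) = 0`.
[cite: CerfDiffeoSphere1968, Ch. I §2, first sentence; Appendice §5, Prop. 4] -/
theorem Diffeomorph.isDiffeotopicToId_of_isOrientationPreserving_of_unitBallDiffeotopyTrivial
    (hn : n ≠ 0) (hK : UnitBallDiffeotopyTrivial (EuclideanSpace ℝ (Fin n)))
    (o : SmoothOrientation (𝓡 n) (Metric.sphere (0 : EuclideanSpace ℝ (Fin (n + 1))) 1))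
    (φ : (Metric.sphere (0 : EuclideanSpace ℝ (Fin (n + 1))) 1) ≃ₘ⟮𝓡 n, 𝓡 n⟯
      (Metric.sphere (0 : EuclideanSpace ℝ (Fin (n + 1))) 1))
    (hφ : φ.IsOrientationPreserving o o) : Diffeomorph.IsDiffeotopicToId φ :=
  Diffeomorph.isDiffeotopicToId_of_isOrientationPreserving_of_compactDiffeotopyTrivial hn
    (CompactDiffeotopyTrivial.of_unitBall hK) o φ hφ

/-! ### (2) ⟹ Théorème 1 as printed -/

/-- **Cerf (1968), Ch. I §2: statement (2) `π₀(Diff(D³; S²)) = 0` implies Théorème 1 as printed,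
`π₀(Diff⁺ S³) = 0`.** In the tree: under the named fact `cerf_pi0DiffDisc_relBoundary_three`
(`CerfPropositionFour.lean`; definitionally `UnitBallDiffeotopyTrivial (EuclideanSpace ℝ (Fin 3))`)
every self-diffeomorphism `φ` of `𝕊³ ⊂ ℝ⁴` preserving a smooth orientation `o` of `𝕊³` (there are
exactly two, `±` the standard one, and "preserving `o`" does not depend on the sign) is
diffeotopic to the identity — `Diffeomorph.isDiffeotopicToId_of_isOrientationPreserving_of_unitBallDiffeotopyTrivial`
at `n = 3`. So (2) is the single unproved leaf under every Cerf statement of the tree, the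
printed Théorème 1 included; its proof is Chapters II–VI of the monograph (Théorème 1″/1‴;
Hatcher, Ann. of Math. 117 (1983)). The orientation-free paraphrase from the same hypothesis is
`cerf_pi0Diff_sphere_three_of_relBoundary` (`CerfPropositionFour.lean`).
[cite: CerfDiffeoSphere1968, Ch. I §2, (2) and first sentence; Ch. I §1, Théorème 1] -/
theorem isDiffeotopicToId_of_isOrientationPreserving_of_relBoundary
    (h : cerf_pi0DiffDisc_relBoundary_three)
    (o : SmoothOrientation (𝓡 3) (Metric.sphere (0 : EuclideanSpace ℝ (Fin 4)) 1))
    (φ : (Metric.sphere (0 : EuclideanSpace ℝ (Fin 4)) 1) ≃ₘ⟮𝓡 3, 𝓡 3⟯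
      (Metric.sphere (0 : EuclideanSpace ℝ (Fin 4)) 1))
    (hφ : φ.IsOrientationPreserving o o) : Diffeomorph.IsDiffeotopicToId φ :=
  Diffeomorph.isDiffeotopicToId_of_isOrientationPreserving_of_unitBallDiffeotopyTrivial
    three_ne_zero ((cerf_pi0DiffDisc_relBoundary_three_iff).mp h) o φ hφ

/-! ### The case `n = 1`, unconditionally: `π₀(Diff⁺ S¹) = 0` -/

/-- **Every orientation-preserving diffeomorphism of the circle is diffeotopic to the identity**
(`π₀(Diff⁺ S¹) = 0`): the oriented form of Proposition 4 at `n = 1`, where its hypothesis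
`π₀(Diff(D¹; S⁰)) = 0` is the tree's theorem `unitBallDiffeotopyTrivial_euclideanSpace_one`
(straight-line diffeotopy of an increasing compactly supported diffeomorphism of the line,
`CerfPropositionFour.lean`). Companion of the orientation-free
`Diffeomorph.isDiffeotopicToId_or_isDiffeotopic_sphereReflection_circle`; classical
(`Diff⁺ S¹ ≃ SO(2)`). [cite: CerfDiffeoSphere1968, Appendice §5, Prop. 4 (n = 1, i = 0)] -/
theorem Diffeomorph.isDiffeotopicToId_of_isOrientationPreserving_circle
    (o : SmoothOrientation (𝓡 1) (Metric.sphere (0 : EuclideanSpace ℝ (Fin 2)) 1))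
    (φ : (Metric.sphere (0 : EuclideanSpace ℝ (Fin 2)) 1) ≃ₘ⟮𝓡 1, 𝓡 1⟯
      (Metric.sphere (0 : EuclideanSpace ℝ (Fin 2)) 1))
    (hφ : φ.IsOrientationPreserving o o) : Diffeomorph.IsDiffeotopicToId φ :=
  Diffeomorph.isDiffeotopicToId_of_isOrientationPreserving_of_unitBallDiffeotopyTrivial one_ne_zero
    unitBallDiffeotopyTrivial_euclideanSpace_one o φ hφ

end Literature.Topology.FourManifolds

end
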